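import Literature.NumberTheory.PAdicHodge.FontaineDpst
import Literature.NumberTheory.GaloisRepresentations.LabelledHodgeTateWeights
import Literature.NumberTheory.GaloisRepresentations.AbsolutelyIrreducibleReduction
import Literature.NumberTheory.GaloisRepresentations.ModPGaloisRep
import Literature.NumberTheory.LFunctions.ChebotarevDensity
import Literature.NumberTheory.LFunctions.DirichletDensityLemmas
import HarnessLib

/-!
# Residual irreducibility on `Γ_{ℚ(ζ_ℓ)}` of the irreducible members of a regular weakly
# compatible system, at a set of primes `ℓ` of Dirichlet density one
# (Barnet-Lamb–Gee–Geraghty–Taylor 2014, Prop. 5.3.2, over `F = ℚ`)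

Topic `Literature/NumberTheory/GaloisRepresentations`.  Cite item of the crux `stmt-Langlands-17765`
(`Summit.Langlands.Langlands.Theses.AbelianSurfaceSerre.SerreGSp4Surjective`), line
`singer-type-evaporation`, stub `stub_singerFamily` (skeleton v4, R5: the residual rigidity
`IrredOnCycKernel` of the `ℓ`-adic companions on a set `good` of primes unbounded above).  One
VOCABULARY predicate, `IsWeaklyCompatibleSystemRat` ([BLGGT] §5.1 over `ℚ`, `(ℓ, ι)`-indexed, read on
Fontaine's pinned datum), one NAMED FACT (D-0014),
`BLGGT2014_prop532_residuallyIrreducible_densityOne`, and its proved projection `….unbounded`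
("density one ⇒ unboundedly many", the form the requesting structure consumes).  The companion
file `NumberTheory/Automorphic/PotentialAutomorphyCompatibleSystemGL4Rational.lean`
(`BLGGT2014_thm551_compatibleSystem_rat_GL4`, Thm. 5.5.1 ibid.) PRODUCES systems in exactly this
predicate, so the two facts compose by `exact`.

## The printed statements (held text arXiv:1010.2561, read 2026-08-17)

T. Barnet-Lamb, T. Gee, D. Geraghty, R. Taylor, *Potential automorphy and change of weight*,
Ann. of Math. 179 (2014) 501–609 [BarnetlambEtAl2014].  NUMBERING: the held text is the arXiv
version, whose §5.2 "Compatible systems: lemmas" is §5.3 of the published version; the result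
below is **Proposition 5.3.2 of the published paper = Proposition 5.2.2 of the held text** (so
cited, as "proposition 5.3.2 of [blggt] … `r̄_{i,λ,j}|_{G_{F(ζ_l)}}` is irreducible", by
Patrikis–Taylor, Compositio 151 (2015), proof of Thm. 2.1, arXiv:1307.1640 p. 9).

* **§5.1** (p. 32), verbatim: "Let `F` denote a number field. By a rank `n` weakly compatible
  system of `l`-adic representations `𝓡` of `G_F` defined over `M` we shall mean a `5`-tuple
  `(M, S, {Q_v(X)}, {r_λ}, {H_τ})` where (1) `M` is a number field; (2) `S` is a finite set of
  primes of `F`; (3) for each prime `v ∉ S` of `F`, `Q_v(X)` is a monic degree `n` polynomial in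
  `M[X]`; (4) for each prime `λ` of `M` (with residue characteristic `l` say)
  `r_λ : G_F → GL_n(M̄_λ)` is a continuous, semi-simple, representation such that • if `v ∉ S`
  and `v ∤ l` is a prime of `F` then `r_λ` is unramified at `v` and `r_λ(Frob_v)` has
  characteristic polynomial `Q_v(X)`, • while if `v | l` then `r_λ|_{G_{F_v}}` is de Rham and in
  the case `v ∉ S` crystalline; (5) for `τ : F ↪ M̄`, `H_τ` is a multiset of `n` integers such
  that for any `M̄ ↪ M̄_λ` over `M` we have `HT_τ(r_λ) = H_τ`. … We will call `𝓡` regular if for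
  each `τ : F ↪ M̄` every element of `H_τ` has multiplicity `1`."  (Notation, p. 6: "`Frob_K`
  … the geometric Frobenius"; "`HT_τ(ε_l) = {−1}`".)
* **Proposition 5.2.2 (held) = 5.3.2 (published)** (p. 33), verbatim: "Suppose that `𝓡` is a
  regular, weakly compatible system of `l`-adic representations of `G_F` defined over `M`. If `s`
  is a sub-representation of `r_λ` then we will write `s̄` for the semi-simplification of the
  reduction of `s`. Also write `l` for the rational prime below `λ`. Then there is a set of
  rational primes `𝓛` of Dirichlet density `1` such that if `s` is an irreducible
  sub-representation of `r_λ` with `λ` dividing an element of `𝓛` then `s̄|_{G_{F(ζ_l)}}` is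
  irreducible."  (Proof, pp. 34–37: Serre–Larsen–Pink `l`-independence of `G_λ/G_λ⁰`, and
  M. Larsen, *Maximality of Galois actions for compatible systems*, Duke Math. J. 80 (1995),
  Thm. 3.17, Prop. 2.6, §§1.12–1.13 [Larsen1995], which supplies the density-one set.)

## Rendering in the tree's vocabulary (read before reviewing)

* **`F = ℚ`, indexing by `(ℓ, ι)`.**  A system is a dependent family
  `𝓡 ℓ ι : Γ_ℚ → GL_n(ℚ̄_ℓ)` (`FramedGaloisRep ℚ (PadicAlgCl ℓ) n`) over all primes `ℓ` and all
  field isomorphisms `ι : ℚ̄_ℓ ≃+* ℂ`, with COMPLEX Frobenius polynomials `Q v ∈ ℂ[X]` whose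
  coefficients lie in one number field `E ⊂ ℂ` (`Subfield ℂ`, `FiniteDimensional ℚ E`) — exactly
  the reparametrisation of [BLGGT]'s `λ`-indexed systems already used by the accepted
  `BLGGT2014_polarized_compatibleSystem_rationalModels` and by the accepted file
  `Automorphic/NonSelfDualGL3GL4CompatibleSystems` (its `GaloisRepFamily ℚ n` is this family type
  definitionally; its `IsWeaklyCompatibleFamily π r H` is the variant ATTACHED TO an automorphic
  `π`, with `π`'s Satake polynomials for the `Q_v`): given `(M, S, {Q_v}, {r_λ}, {H})` and `M ⊂ ℂ`, the embedding `ι⁻¹|_M` induces a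
  prime `λ ∣ ℓ` and an `M`-isomorphism `M̄_λ ≅ ℚ̄_ℓ` along which `r_λ` becomes `𝓡 ℓ ι` with
  Frobenius polynomials `ι⁻¹(Q_v)`; conversely a family gives a system over `E` by choosing one
  `ι` per `λ` (two `ι` inducing the same `λ` differ on `E` by `σ ∈ Aut(ℚ̄_ℓ/ℚ_ℓ)`, and the
  members are then `σ`-conjugate by Chebotarev–Brauer–Nesbitt, which preserves every clause below
  and the conclusion).  The tree's `HasFrobCharpolyAt` is the characteristic polynomial of the
  ARITHMETIC Frobenius; [BLGGT]'s `Q_v` is that of the geometric one, i.e. the reciprocal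
  polynomial `Xⁿ Q_v(0)⁻¹ Q_v(X⁻¹)`, which has coefficients in the same number field — the class
  of systems is unchanged.  "Monic of degree `n`" is implied (Frobenius elements exist,
  `exists_isArithFrobAt_of_mem_primesAbove_holds`) and not restated.
* **`p`-adic Hodge clauses** at `v ∣ ℓ` are read on THE pinned datum
  `fontainePstAdicCompletion v ℓ hv = (B_dR(ℚ_v), WD ∘ D_pst)` (`IsDeRhamFramed`,
  `IsCrystallineFramed`), and "`HT_τ(r_λ) = H`" for the unique `τ : ℚ ↪ M̄` is
  `labelledHodgeTateWeightsAt … τ = H` for every `ℚ_ℓ`-ALGEBRA label `τ : ℚ_v →ₐ[ℚ_ℓ] ℚ̄_ℓ` of the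
  datum's (canonical) algebra structure — verbatim the idiom of the accepted
  `BLGGT2014_thm421_rat_GL4` and of the requesting line's `IsCrystallineWithWeightsAt`
  (convention `HT(ε_ℓ) = {−1}` on both sides).  `Multiset.card H = n` is clause (5).
* **"`s` an irreducible sub-representation of `r_λ`"** is specialised to `s = r_λ` itself:
  hypothesis `(𝓡 ℓ ι).toGaloisRep.IsIrreducible` (irreducible over `ℚ̄_ℓ`).
  -- TODO(general form): proper irreducible sub-representations `s ⊊ r_λ`.
* **"`s̄|_{G_{F(ζ_l)}}` is irreducible"**, `s̄` the semisimplified reduction over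
  `𝔽 = 𝒪_{ℚ̄_ℓ}/𝔪`: rendered, as in `BLGGT2014_thm421_rat_GL4` and the line's `ReducesTo` /
  `IrredOnCycKernel`, by: for EVERY finite field `k` of characteristic `ℓ`, every continuous
  `ρbar : Γ_ℚ → GL_n(k)` and every ring homomorphism `red : 𝒪_{ℚ̄_ℓ} → k̄` along which the
  (integral) characteristic polynomials of `𝓡 ℓ ι` reduce to those of `ρbar ⊗_k k̄`, the
  restriction of `ρbar ⊗_k k̄` to `ker ε̄_ℓ = Γ_{ℚ(ζ_ℓ)}` (accepted `modPCyclotomicCharacterZMod`) is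
  `Representation.IsIrreducible`.  Equivalent on paper: such a `red` kills `ℓ`, hence has kernel
  `𝔪` and embeds `𝔽 ≅ k̄`; `(ρbar ⊗ k̄)^{ss} ≅ s̄ ⊗_𝔽 k̄` (Brauer–Nesbitt, `brauerNesbitt_holds`);
  the restriction to the normal subgroup `Γ_{ℚ(ζ_ℓ)}` of a semisimplification is the
  semisimplification of the restriction (Clifford), and a representation with irreducible
  semisimplification is irreducible; conversely `s̄` itself is such a `ρbar` over a finite `k`.
* **"Dirichlet density `1`"** is the accepted `Literature.NumberTheory.LFunctions.HasDirichletDensity L 1`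
  (Neukirch VII (13.1)); the projection `….unbounded` extracts "for every `N` a prime `ℓ ≥ N` in
  `L`" (`PrimeSum.exists_gt_of_tendsto_pos`), which is what the requesting structure's
  `good_unbounded` consumes.
  -- TODO(general form): arbitrary number field `F` (and `F(ζ_l)`), systems indexed by the
  -- primes of `M` with `M̄_λ`-coefficients.

## References

* [BarnetlambEtAl2014] Ann. of Math. 179 (2014): §5.1 (weakly compatible systems, regular),
  Prop. 5.3.2 (= arXiv:1010.2561 Prop. 5.2.2, pp. 33–37), Lemma 5.3.1.
* [Larsen1995] M. Larsen, Duke Math. J. 80 (1995) 601–630, Thm. 3.17, Prop. 2.6 (the input of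
  the proof).
* [PatrikisTaylor2014] Compositio Math. 151 (2015), proof of Thm. 2.1 (p. 9 of arXiv:1307.1640:
  the citation fixing the published numbering 5.3.2).
-/

noncomputable section

open scoped NumberField
open NumberField IsDedekindDomain Field Filter
open Literature.NumberTheory.PAdicHodge Literature.NumberTheory.LFunctions

namespace Literature.NumberTheory.GaloisRepresentations

/-- **A rank-`n` weakly compatible system of `ℓ`-adic representations of `Γ_ℚ`**
([BLGGT] §5.1, `F = ℚ`), `(ℓ, ι)`-indexed and read on Fontaine's pinned datum: the data are a
finite set `S` of finite places of `ℚ`, complex Frobenius polynomials `Q v ∈ ℂ[X]`, a multiset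
`H` of integers (the common labelled Hodge–Tate weights) and the members
`𝓡 ℓ ι : Γ_ℚ → GL_n(ℚ̄_ℓ)` for every prime `ℓ` and every `ι : ℚ̄_ℓ ≃+* ℂ`; the clauses are
(1) the `Q v`, `v ∉ S`, have all their coefficients in ONE number field `E ⊂ ℂ` ("defined over
`M`"); (5) `card H = n`; and for every `(ℓ, ι)`: (4) `𝓡 ℓ ι` is semisimple; at every `v ∉ S`
with `v ∤ ℓ` it is unramified with arithmetic-Frobenius characteristic polynomial `ι⁻¹(Q v)`
(`HasFrobCharpolyAt`; [BLGGT]'s `Q_v` is the geometric one, the reciprocal polynomial — same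
class of systems); at the place `v ∣ ℓ` it is de Rham for `fontainePstAdicCompletion v ℓ hv`,
crystalline if `v ∉ S`, with `τ`-labelled Hodge–Tate weights `H` for every `ℚ_ℓ`-algebra label
`τ : ℚ_v →ₐ[ℚ_ℓ] ℚ̄_ℓ`.  Regularity (`H.Nodup`) is NOT part of the predicate.  See the module
docstring (indexing, Frobenius normalisation). [cite: BarnetlambEtAl2014, §5.1] -/
def IsWeaklyCompatibleSystemRat (n : ℕ) (S : Finset (HeightOneSpectrum (𝓞 ℚ)))
    (Q : HeightOneSpectrum (𝓞 ℚ) → Polynomial ℂ) (H : Multiset ℤ)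
    (𝓡 : ∀ (ℓ : ℕ) [Fact ℓ.Prime], (PadicAlgCl ℓ ≃+* ℂ) → FramedGaloisRep ℚ (PadicAlgCl ℓ) n) :
    Prop :=
  (∃ E : Subfield ℂ, FiniteDimensional ℚ E ∧
      ∀ v : HeightOneSpectrum (𝓞 ℚ), v ∉ S → ∀ i : ℕ, (Q v).coeff i ∈ E) ∧
  Multiset.card H = n ∧
  ∀ (ℓ : ℕ) [Fact ℓ.Prime] (ι : PadicAlgCl ℓ ≃+* ℂ),
    (𝓡 ℓ ι).toGaloisRep.IsSemisimple ∧
    (∀ v : HeightOneSpectrum (𝓞 ℚ), v ∉ S → ((ℓ : ℕ) : 𝓞 ℚ) ∉ v.asIdeal →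
        (𝓡 ℓ ι).IsUnramifiedAt v ∧
          (𝓡 ℓ ι).HasFrobCharpolyAt v ((Q v).map (ι.symm : ℂ ≃+* PadicAlgCl ℓ).toRingHom)) ∧
    ∀ (v : HeightOneSpectrum (𝓞 ℚ)) (hv : ((ℓ : ℕ) : 𝓞 ℚ) ∈ v.asIdeal),
      (fontainePstAdicCompletion v ℓ hv).IsDeRhamFramed ((𝓡 ℓ ι).toLocal v) ∧
      (v ∉ S → (fontainePstAdicCompletion v ℓ hv).IsCrystallineFramed ((𝓡 ℓ ι).toLocal v)) ∧
      letI := (fontainePstAdicCompletion v ℓ hv).algebra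
      ∀ τ : v.adicCompletion ℚ →ₐ[ℚ_[ℓ]] PadicAlgCl ℓ,
        (𝓡 ℓ ι).labelledHodgeTateWeightsAt v (fontainePstAdicCompletion v ℓ hv).algebra
            (fontainePstAdicCompletion v ℓ hv).𝔅 τ.toRingHom = H

/-- The clauses of a weakly compatible system at one index `(ℓ, ι)`: semisimplicity, the
unramified/Frobenius clause away from `S ∪ {ℓ}`, and the `p`-adic Hodge clauses at `v ∣ ℓ`.
[folklore] -/
theorem IsWeaklyCompatibleSystemRat.member {n : ℕ} {S : Finset (HeightOneSpectrum (𝓞 ℚ))}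
    {Q : HeightOneSpectrum (𝓞 ℚ) → Polynomial ℂ} {H : Multiset ℤ}
    {𝓡 : ∀ (ℓ : ℕ) [Fact ℓ.Prime], (PadicAlgCl ℓ ≃+* ℂ) → FramedGaloisRep ℚ (PadicAlgCl ℓ) n}
    (h : IsWeaklyCompatibleSystemRat n S Q H 𝓡) (ℓ : ℕ) [Fact ℓ.Prime]
    (ι : PadicAlgCl ℓ ≃+* ℂ) :
    (𝓡 ℓ ι).toGaloisRep.IsSemisimple ∧
    (∀ v : HeightOneSpectrum (𝓞 ℚ), v ∉ S → ((ℓ : ℕ) : 𝓞 ℚ) ∉ v.asIdeal →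
        (𝓡 ℓ ι).IsUnramifiedAt v ∧
          (𝓡 ℓ ι).HasFrobCharpolyAt v ((Q v).map (ι.symm : ℂ ≃+* PadicAlgCl ℓ).toRingHom)) ∧
    ∀ (v : HeightOneSpectrum (𝓞 ℚ)) (hv : ((ℓ : ℕ) : 𝓞 ℚ) ∈ v.asIdeal),
      (fontainePstAdicCompletion v ℓ hv).IsDeRhamFramed ((𝓡 ℓ ι).toLocal v) ∧
      (v ∉ S → (fontainePstAdicCompletion v ℓ hv).IsCrystallineFramed ((𝓡 ℓ ι).toLocal v)) ∧
      letI := (fontainePstAdicCompletion v ℓ hv).algebra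
      ∀ τ : v.adicCompletion ℚ →ₐ[ℚ_[ℓ]] PadicAlgCl ℓ,
        (𝓡 ℓ ι).labelledHodgeTateWeightsAt v (fontainePstAdicCompletion v ℓ hv).algebra
            (fontainePstAdicCompletion v ℓ hv).𝔅 τ.toRingHom = H :=
  h.2.2 ℓ ι

/-- **Barnet-Lamb–Gee–Geraghty–Taylor 2014, Proposition 5.3.2 (= arXiv:1010.2561 Prop. 5.2.2),
over `F = ℚ`, for the member itself (`s = r_λ`).**  Let `𝓡` be a REGULAR (`H.Nodup`) weakly
compatible system of rank-`n` `ℓ`-adic representations of `Γ_ℚ` (`IsWeaklyCompatibleSystemRat`,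
[BLGGT] §5.1).  Then there is a set `L` of rational primes of Dirichlet density `1`
(`HasDirichletDensity L 1`) such that for every prime `ℓ ∈ L` and every `ι : ℚ̄_ℓ ≃ ℂ`: IF the
member `𝓡 ℓ ι` is irreducible, THEN its residual representation is irreducible on `Γ_{ℚ(ζ_ℓ)}` —
for every finite field `k` of characteristic `ℓ`, every continuous `ρbar : Γ_ℚ → GL_n(k)` and
every `red : 𝒪_{ℚ̄_ℓ} → k̄` along which the integral characteristic polynomials of `𝓡 ℓ ι` reduce
to those of `ρbar ⊗_k k̄`, the restriction of `ρbar ⊗_k k̄` to `ker ε̄_ℓ` is irreducible.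
Printed: "Suppose that `𝓡` is a regular, weakly compatible system of `l`-adic representations of
`G_F` defined over `M`. … Then there is a set of rational primes `𝓛` of Dirichlet density `1`
such that if `s` is an irreducible sub-representation of `r_λ` with `λ` dividing an element of
`𝓛` then `s̄|_{G_{F(ζ_l)}}` is irreducible."  Specialisations (`F = ℚ`, `s = r_λ`) and the
`(ℓ, ι)` / residual renderings: module docstring.  Named fact (D-0014); users take
`(h : BLGGT2014_prop532_residuallyIrreducible_densityOne)`.
-- TODO(general form): number field `F`; irreducible sub-representations `s ⊊ r_λ`.
[cite: BarnetlambEtAl2014, Prop. 5.3.2 (= arXiv:1010.2561 Prop. 5.2.2) and §5.1]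
[cite: Larsen1995, Thm. 3.17 (the density-one input of the proof)] -/
def BLGGT2014_prop532_residuallyIrreducible_densityOne : Prop :=
  ∀ (n : ℕ) (S : Finset (HeightOneSpectrum (𝓞 ℚ))) (Q : HeightOneSpectrum (𝓞 ℚ) → Polynomial ℂ)
    (H : Multiset ℤ)
    (𝓡 : ∀ (ℓ : ℕ) [Fact ℓ.Prime], (PadicAlgCl ℓ ≃+* ℂ) → FramedGaloisRep ℚ (PadicAlgCl ℓ) n),
    IsWeaklyCompatibleSystemRat n S Q H 𝓡 → H.Nodup →
      ∃ L : Set ℕ, HasDirichletDensity L 1 ∧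
        ∀ (ℓ : ℕ) [Fact ℓ.Prime], ℓ ∈ L → ∀ ι : PadicAlgCl ℓ ≃+* ℂ,
          -- `s = r_λ` is irreducible
          (𝓡 ℓ ι).toGaloisRep.IsIrreducible →
          -- the residual representation `s̄`, read in `k̄` for a finite field `k` of characteristic `ℓ`
          ∀ (k : Type) [Field k] [Fintype k] [CharP k ℓ] [TopologicalSpace k] [DiscreteTopology k]
            (ρbar : FramedGaloisRep ℚ k n)
            (red : (Valued.v : Valuation (PadicAlgCl ℓ) NNReal).valuationSubring →+*
              AlgebraicClosure k),
            (∀ g : absoluteGaloisGroup ℚ,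
              ∃ P : Polynomial (Valued.v : Valuation (PadicAlgCl ℓ) NNReal).valuationSubring,
                P.map (Valued.v : Valuation (PadicAlgCl ℓ) NNReal).valuationSubring.subtype =
                    FramedRep.charpoly (𝓡 ℓ ι) g ∧
                  P.map red = (FramedRep.charpoly ρbar g).map (algebraMap k (AlgebraicClosure k))) →
            -- `s̄|_{Γ_{ℚ(ζ_ℓ)}}` is irreducible (`Γ_{ℚ(ζ_ℓ)} = ker ε̄_ℓ`)
            Representation.IsIrreducible
              (((FramedRep.baseChangeRepresentation (algebraMap k (AlgebraicClosure k)) ρbar).comp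
                  (modPCyclotomicCharacterZMod ℚ ℓ).ker.subtype :
                Representation (AlgebraicClosure k) (modPCyclotomicCharacterZMod ℚ ℓ).ker
                  (Fin n → AlgebraicClosure k)))

/-- Projection of `BLGGT2014_prop532_residuallyIrreducible_densityOne` onto the form the
requesting structure consumes ("a set of primes UNBOUNDED ABOVE"): a set of Dirichlet density one
contains a prime `ℓ ≥ N` for every `N` (`PrimeSum.exists_gt_of_tendsto_pos`); weaker than the
fact. [folklore] -/
theorem BLGGT2014_prop532_residuallyIrreducible_densityOne.unbounded
    (h : BLGGT2014_prop532_residuallyIrreducible_densityOne)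
    {n : ℕ} {S : Finset (HeightOneSpectrum (𝓞 ℚ))} {Q : HeightOneSpectrum (𝓞 ℚ) → Polynomial ℂ}
    {H : Multiset ℤ}
    {𝓡 : ∀ (ℓ : ℕ) [Fact ℓ.Prime], (PadicAlgCl ℓ ≃+* ℂ) → FramedGaloisRep ℚ (PadicAlgCl ℓ) n}
    (h𝓡 : IsWeaklyCompatibleSystemRat n S Q H 𝓡) (hreg : H.Nodup) :
    ∃ L : Set ℕ, (∀ N : ℕ, ∃ ℓ : ℕ, ℓ.Prime ∧ ℓ ∈ L ∧ N ≤ ℓ) ∧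
      ∀ (ℓ : ℕ) [Fact ℓ.Prime], ℓ ∈ L → ∀ ι : PadicAlgCl ℓ ≃+* ℂ,
        (𝓡 ℓ ι).toGaloisRep.IsIrreducible →
        ∀ (k : Type) [Field k] [Fintype k] [CharP k ℓ] [TopologicalSpace k] [DiscreteTopology k]
          (ρbar : FramedGaloisRep ℚ k n)
          (red : (Valued.v : Valuation (PadicAlgCl ℓ) NNReal).valuationSubring →+*
            AlgebraicClosure k),
          (∀ g : absoluteGaloisGroup ℚ,
            ∃ P : Polynomial (Valued.v : Valuation (PadicAlgCl ℓ) NNReal).valuationSubring,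
              P.map (Valued.v : Valuation (PadicAlgCl ℓ) NNReal).valuationSubring.subtype =
                  FramedRep.charpoly (𝓡 ℓ ι) g ∧
                P.map red = (FramedRep.charpoly ρbar g).map (algebraMap k (AlgebraicClosure k))) →
          Representation.IsIrreducible
            (((FramedRep.baseChangeRepresentation (algebraMap k (AlgebraicClosure k)) ρbar).comp
                (modPCyclotomicCharacterZMod ℚ ℓ).ker.subtype :
              Representation (AlgebraicClosure k) (modPCyclotomicCharacterZMod ℚ ℓ).ker
                (Fin n → AlgebraicClosure k))) := by
  obtain ⟨L, hL, hirr⟩ := h n S Q H 𝓡 h𝓡 hreg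
  refine ⟨L, fun N => ?_, hirr⟩
  classical
  obtain ⟨ℓ, hℓ, hℓL, hNℓ⟩ :=
    PrimeSum.exists_gt_of_tendsto_pos (X := L) one_pos
      (by convert hasDirichletDensity_iff.mp hL using 3) N
  exact ⟨ℓ, hℓ, hℓL, hNℓ.le⟩

end Literature.NumberTheory.GaloisRepresentations

end
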